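/-
Copyright (c) 2026 the pub-hodgecm-mathlib formalisation cell (harness21).  Prover seat hodgecm-mathlib-K2E4-p14 (g7): Track B «K2-LIT», ENGINE E1,
h413 = stmt-HodgeConjecture-24833; DEAL (23)∕RULING (31) of K2E1-plan (g6), FILE 1 §1 (α): «ARCHIMEDEAN FACTOR OF THE `U(2,1)` INTERTWINING CONSTANT IS INTEGRABLE FOR σ > 1».
-/
import Summits.HodgeConjecture.HodgeConjecture.Theorems.K2E1IntertwiningFiniteIntegrabilityU3    -- ★ FILE 3′ (K2E2-p12 g5): the `ARCH₃` token and its measurable-space binders; brings (ν-1) `K2E1AdelicFourierEnvelope`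
import Summits.HodgeConjecture.HodgeConjecture.Theorems.K2E1IntertwiningLocalFactorIntegrableU2  -- ★ N = 2 FILE B: `integrable_one_add_mul_sq_rpow_neg`; brings Haar uniqueness, the Japanese bracket
import Literature.NumberTheory.Automorphic.AdeleRingTopology                                     -- ★ `infiniteAdeleRingHomeomorph` (= `ringEquiv_mixedSpace` as a homeomorphism)
import Literature.NumberTheory.Automorphic.AdelicGLnGlue                                         -- ★ `continuous_ringEquiv_mixedSpace`, `continuous_ringEquiv_mixedSpace_symm`
import HarnessLib

/-!
# K2·E1 — `K2E1IntertwiningArchFactorIntegrableU3` (DEAL (23)∕(31) FILE 1 §1 (α)): THE ARCHIMEDEAN FACTOR `ARCH₃(Ξ, a)^{−σ}` OF THE `U(2,1)` INTERTWINING CONSTANT IS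
# `μ_{E,∞} ⊗ μ_{F,∞}`-INTEGRABLE FOR EVERY REAL `σ > 1` — in particular AT THE POLE `σ = 2`

Track B ∕ K2-LIT, crux h413 = `stmt-HodgeConjecture-24833`, route of record `HCCMUnconditional`; cell `hodgecm-mathlib`, squad K2, ENGINE E1 (campaign «EIS-RANK-ONE», R7 at
`N = 3`, (R-b)₃ letter-free).  THEOREMS ONLY (no `def`, no instance, no notation, no named-fact hypothesis, no `sorry`; default heartbeats); lane
`--supports stmt-HodgeConjecture-24833 --as helper` (count-neutral).  CM pair `L ∕ L⁺`, `δ ∈ L⁻ ∖ 0`.  TOKEN (★ FILE 3′ `K2E1IntertwiningFiniteIntegrabilityU3`, ★ (a2)₃):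
  `ARCH₃(Ξ, a) = ∏_{w ∣ ∞} ((1 + ‖Ξ_w‖²∕2)² + (wδ)²·a_{w|L⁺}²)`,  `Ξ ∈ L ⊗ ℝ = InfiniteAdeleRing L`, `a ∈ L⁺ ⊗ ℝ` read through `ringEquiv_mixedSpace L⁺`.

THE MATHEMATICS [MoeglinWaldspurger1995, II.1.6–II.1.7; Langlands1976, Appendix; Titchmarsh1939, §2.8].  Per complex place `w` of `L` (real place `v = w|L⁺`), with `B = (1 + |X|²∕2)² > 0`,
`c = (wδ)² > 0`:  `∫_ℝ (B + c a²)^{−σ} da = B^{½−σ}·c^{−½}·∫_ℝ (1+u²)^{−σ} du` (`σ > ½`, substitution `u = √(c∕B)·a`), and `∫_ℂ (1 + |X|²∕2)^{1−2σ} dX < ∞` iff `2(2σ−1) > 2` iff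
`σ > 1` (Mathlib `integrable_rpow_neg_one_add_norm_sq`, `finrank_ℝ ℂ = 2`).  By Tonelli on `(Π_w ℂ) × (Π_v ℝ)` the product `∏_w ((1 + |X_w|²∕2)² + c_w a_v²)^{−σ}` is integrable for
`σ > 1` (slices: `Integrable.fintype_prod`; norm marginal: `integral_fintype_prod_eq_prod` and the one-place formula), and the adelic statement follows by transport along
`ringEquiv_mixedSpace` (★ `infiniteAdeleRingHomeomorph`, an additive homeomorphism; `InfinitePlace L ≃ InfinitePlace L⁺`, all places of `L` complex, of `L⁺` real — Mathlib
`IsCMField.equivInfinitePlace`) and Haar uniqueness (`isAddLeftInvariant_eq_smul`): EVERY pair of additive Haar measures `μ_{E,∞}`, `μ_{F,∞}`.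
* §1 `integrable_and_integral_add_mul_sq_rpow_neg` (one real place), `integrable_one_add_half_norm_sq_rpow` (one complex place).
* §2 **`integrable_prod_archPlace_rpow_neg`** — Tonelli on `(κ₁ → ℂ) × (κ₂ → ℝ)` along index bijections `e₁ : ι ≃ κ₁`, `e₂ : ι ≃ κ₂` (volume), `σ > 1`.
* §3 **`integrable_arch_rpow_neg_prod`** (HEAD) — `((ARCH₃(Ξ,a)^{−σ} : ℝ) : ℂ) ∈ L¹(μ_{E,∞} ⊗ μ_{F,∞})` for every real `σ > 1` and all additive Haar `μ_{E,∞}`, `μ_{F,∞}`; `arch_rpow_neg_le_of_le`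
  (monotonicity in `σ`, the base being `≥ 1`) and **`norm_integral_integral_arch_rpow_le`**: for `σ₀ > 1` and every `σ ≥ σ₀`,
  `‖∫∫ ((ARCH₃^{−σ} : ℝ) : ℂ) dμ_{F,∞} dμ_{E,∞}‖ ≤ ∫ ARCH₃^{−σ₀} d(μ_{E,∞} ⊗ μ_{F,∞})` — the `σ`-UNIFORM archimedean bound the (R-b)₃ pay-out consumes at `σ₀ = 2`.
HONEST LABEL: HC_CM is proved only modulo the 7 printed citations (2 remaining named inputs: hLiu418 = `stmt-HodgeConjecture-24832`, h413 = `stmt-HodgeConjecture-24833`) until rung 0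
closes; this file asserts no named fact and closes no socket; count-neutral; unconditional real analysis ∕ measure theory.

## References
* [MoeglinWaldspurger1995] C. Mœglin, J.-L. Waldspurger, *Spectral Decomposition and Eisenstein Series* (1995): II.1.6–II.1.7.
* [Langlands1976] R. P. Langlands, *On the Functional Equations Satisfied by Eisenstein Series*, LNM 544 (1976): Appendix.
* [Titchmarsh1939] E. C. Titchmarsh, *The Theory of Functions*, 2nd ed. (1939): §2.8.
-/

set_option autoImplicit false
set_option linter.dupNamespace false -- the mandated namespace repeats `HodgeConjecture.HodgeConjecture`

noncomputable section

open MeasureTheory MeasureTheory.Measure NumberField NumberField.InfinitePlace NumberField.mixedEmbedding Set Filter Function Topology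
open scoped ENNReal NNReal Classical
open Literature.NumberTheory.Automorphic
open Summit.HodgeConjecture.HodgeConjecture.Cruxes.H413
open Summit.HodgeConjecture.HodgeConjecture.Cruxes.H413.K2E1IntertwiningLocalFactorIntegrableU2 (integrable_one_add_mul_sq_rpow_neg)

namespace Summit.HodgeConjecture.HodgeConjecture.Cruxes.H413.K2E1IntertwiningArchFactorIntegrableU3

/-! ## §1 One place: the real line integral and the complex plane integral -/

/-- **One real place**: for `B, c > 0` and `σ > ½`, `a ↦ (B + c a²)^{−σ}` is integrable on `ℝ` and `∫_ℝ (B + c a²)^{−σ} da = B^{½−σ}·c^{−½}·∫_ℝ (1+u²)^{−σ} du`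
(`(B + c a²)^{−σ} = B^{−σ}(1 + (c∕B)a²)^{−σ}`, ★ `integrable_one_add_mul_sq_rpow_neg`, substitution `u = √(c∕B)·a`). [cite: Titchmarsh1939, §2.8] -/
theorem integrable_and_integral_add_mul_sq_rpow_neg {B c σ : ℝ} (hB : 0 < B) (hc : 0 < c) (hσ : 1 / 2 < σ) :
    Integrable (fun a : ℝ => (B + c * a ^ 2) ^ (-σ)) ∧
      ∫ a, (B + c * a ^ 2) ^ (-σ) = B ^ (1 / 2 - σ) * c ^ (-(1 / 2 : ℝ)) * ∫ u, (1 + u ^ 2) ^ (-σ) := by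
  have hk : 0 < c / B := div_pos hc hB
  have hpt : ∀ a : ℝ, (B + c * a ^ 2) ^ (-σ) = B ^ (-σ) * (1 + c / B * a ^ 2) ^ (-σ) := fun a => by
    rw [← Real.mul_rpow hB.le (by positivity)]
    congr 1
    field_simp
  have hint1 : Integrable (fun a : ℝ => (1 + c / B * a ^ 2) ^ (-σ)) := integrable_one_add_mul_sq_rpow_neg hk hσ
  refine ⟨(hint1.const_mul _).congr (Eventually.of_forall fun a => (hpt a).symm), ?_⟩
  simp_rw [hpt, integral_const_mul]
  have hsub : ∫ a : ℝ, (1 + c / B * a ^ 2) ^ (-σ) = (Real.sqrt (c / B))⁻¹ * ∫ u : ℝ, (1 + u ^ 2) ^ (-σ) := by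
    have h := Measure.integral_comp_mul_left (fun u : ℝ => (1 + u ^ 2) ^ (-σ)) (Real.sqrt (c / B))
    have hsq : ∀ a : ℝ, (Real.sqrt (c / B) * a) ^ 2 = c / B * a ^ 2 := fun a => by
      rw [mul_pow, Real.sq_sqrt hk.le]
    simp only [hsq] at h
    rw [h, smul_eq_mul, abs_of_pos (inv_pos.2 (Real.sqrt_pos.2 hk))]
  rw [hsub, ← mul_assoc]
  congr 1
  have hinv : (Real.sqrt (c / B))⁻¹ = B ^ (1 / 2 : ℝ) * c ^ (-(1 / 2 : ℝ)) := by
    rw [Real.sqrt_eq_rpow, Real.div_rpow hc.le hB.le, inv_div, Real.rpow_neg hc.le, div_eq_mul_inv]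
  rw [hinv, ← mul_assoc, ← Real.rpow_add hB]
  congr 1
  · norm_num [show (-σ + 1 / 2 : ℝ) = 1 / 2 - σ by ring]

/-- **One complex place**: `X ↦ (1 + ‖X‖²∕2)^{1−2σ}` is integrable on `ℂ` for `σ > 1` (Mathlib `integrable_rpow_neg_one_add_norm_sq` with `finrank_ℝ ℂ = 2`, and
`(1 + ‖X‖²∕2)^{1−2σ} ≤ 2^{2σ−1}·(1 + ‖X‖²)^{1−2σ}`). [cite: Titchmarsh1939, §2.8] -/
theorem integrable_one_add_half_norm_sq_rpow {σ : ℝ} (hσ : 1 < σ) :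
    Integrable (fun X : ℂ => (1 + ‖X‖ ^ 2 / 2) ^ (1 - 2 * σ)) := by
  have h0 : Integrable (fun X : ℂ => ((1 : ℝ) + ‖X‖ ^ 2) ^ (-(2 * (2 * σ - 1)) / 2)) :=
    integrable_rpow_neg_one_add_norm_sq (by rw [Complex.finrank_real_complex]; push_cast; linarith)
  have h1 : Integrable (fun X : ℂ => (2 : ℝ) ^ (2 * σ - 1) * ((1 : ℝ) + ‖X‖ ^ 2) ^ (1 - 2 * σ)) := by
    refine (h0.const_mul ((2 : ℝ) ^ (2 * σ - 1))).congr (Eventually.of_forall fun X => ?_)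
    simp only
    rw [show (-(2 * (2 * σ - 1)) / 2 : ℝ) = 1 - 2 * σ by ring]
  refine h1.mono' ((continuous_const.add ((continuous_norm.pow 2).div_const 2)).measurable.pow_const _).aestronglyMeasurable
    (Eventually.of_forall fun X => ?_)
  rw [Real.norm_of_nonneg (Real.rpow_nonneg (by positivity) _)]
  have hle : ((1 : ℝ) + ‖X‖ ^ 2) / 2 ≤ 1 + ‖X‖ ^ 2 / 2 := by nlinarith [sq_nonneg ‖X‖]
  calc (1 + ‖X‖ ^ 2 / 2) ^ (1 - 2 * σ) ≤ (((1 : ℝ) + ‖X‖ ^ 2) / 2) ^ (1 - 2 * σ) := Real.rpow_le_rpow_of_nonpos (by positivity) hle (by linarith)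
    _ = (2 : ℝ) ^ (2 * σ - 1) * ((1 : ℝ) + ‖X‖ ^ 2) ^ (1 - 2 * σ) := by
        rw [Real.div_rpow (by positivity) (by norm_num), div_eq_mul_inv, ← Real.rpow_neg (by norm_num), neg_sub, mul_comm]

/-! ## §2 Tonelli on `(κ₁ → ℂ) × (κ₂ → ℝ)` -/

/-- **THE PLACE-PRODUCT IS INTEGRABLE FOR `σ > 1`** (volume on `(κ₁ → ℂ) × (κ₂ → ℝ)`, index bijections `e₁ : ι ≃ κ₁`, `e₂ : ι ≃ κ₂`, constants `c_i > 0`):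
`(z, t) ↦ ∏_i ((1 + ‖z_{e₁ i}‖²∕2)² + c_i·t_{e₂ i}²)^{−σ} ∈ L¹` — Tonelli (`integrable_prod_iff`): every `z`-slice is a product of one-variable integrable functions
(`Integrable.fintype_prod`, §1), and the norm marginal `z ↦ ∏_i (1 + ‖z_{e₁ i}‖²∕2)^{1−2σ}·c_i^{−½}·∫(1+u²)^{−σ}` (`integral_fintype_prod_eq_prod`, §1) is again such a product (§1).
[cite: MoeglinWaldspurger1995, II.1.6] [cite: Titchmarsh1939, §2.8] -/
theorem integrable_prod_archPlace_rpow_neg {ι κ₁ κ₂ : Type*} [Fintype ι] [Fintype κ₁] [Fintype κ₂] (e₁ : ι ≃ κ₁) (e₂ : ι ≃ κ₂)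
    (c : ι → ℝ) (hc : ∀ i, 0 < c i) {σ : ℝ} (hσ : 1 < σ) :
    Integrable (fun p : (κ₁ → ℂ) × (κ₂ → ℝ) => (∏ i, ((1 + ‖p.1 (e₁ i)‖ ^ 2 / 2) ^ 2 + c i * (p.2 (e₂ i)) ^ 2)) ^ (-σ))
      ((Measure.pi fun _ : κ₁ => (volume : Measure ℂ)).prod (Measure.pi fun _ : κ₂ => (volume : Measure ℝ))) := by
  have hσ' : 1 / 2 < σ := by linarith
  have hq : ∀ (X : ℂ) (i : ι) (t : ℝ), 0 < (1 + ‖X‖ ^ 2 / 2) ^ 2 + c i * t ^ 2 := fun X i t => by have := hc i; positivity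
  -- the `z`-slice as a product over `κ₂`
  have hslice : ∀ (z : κ₁ → ℂ) (t : κ₂ → ℝ), (∏ i, ((1 + ‖z (e₁ i)‖ ^ 2 / 2) ^ 2 + c i * (t (e₂ i)) ^ 2)) ^ (-σ) =
      ∏ k : κ₂, ((1 + ‖z (e₁ (e₂.symm k))‖ ^ 2 / 2) ^ 2 + c (e₂.symm k) * (t k) ^ 2) ^ (-σ) := by
    intro z t
    rw [← Real.finsetProd_rpow _ _ (fun i _ => (hq _ i _).le)]
    exact Fintype.prod_equiv e₂ _ _ fun i => by simp only [Equiv.symm_apply_apply]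
  -- measurability
  have hmeas : AEStronglyMeasurable (fun p : (κ₁ → ℂ) × (κ₂ → ℝ) => (∏ i, ((1 + ‖p.1 (e₁ i)‖ ^ 2 / 2) ^ 2 + c i * (p.2 (e₂ i)) ^ 2)) ^ (-σ))
      ((Measure.pi fun _ : κ₁ => (volume : Measure ℂ)).prod (Measure.pi fun _ : κ₂ => (volume : Measure ℝ))) := by
    refine (Continuous.measurable ?_).pow_const _ |>.aestronglyMeasurable
    exact continuous_finsetProd _ fun i _ =>
      ((continuous_const.add (((continuous_norm.comp ((continuous_apply (e₁ i)).comp continuous_fst)).pow 2).div_const 2)).pow 2).add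
        (continuous_const.mul (((continuous_apply (e₂ i)).comp continuous_snd).pow 2))
  refine (integrable_prod_iff hmeas).2 ⟨Eventually.of_forall fun z => ?_, ?_⟩
  · -- slices
    have h : Integrable (fun t : κ₂ → ℝ => ∏ k : κ₂, ((1 + ‖z (e₁ (e₂.symm k))‖ ^ 2 / 2) ^ 2 + c (e₂.symm k) * (t k) ^ 2) ^ (-σ))
        (Measure.pi fun _ : κ₂ => (volume : Measure ℝ)) :=
      Integrable.fintype_prod (f := fun k (s : ℝ) => ((1 + ‖z (e₁ (e₂.symm k))‖ ^ 2 / 2) ^ 2 + c (e₂.symm k) * s ^ 2) ^ (-σ))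
        fun k => (integrable_and_integral_add_mul_sq_rpow_neg (pow_pos (by positivity) 2) (hc _) hσ').1
    exact h.congr (Eventually.of_forall fun t => (hslice z t).symm)
  · -- the norm marginal, computed
    have hmarg : ∀ z : κ₁ → ℂ, ∫ t : κ₂ → ℝ, ‖(∏ i, ((1 + ‖z (e₁ i)‖ ^ 2 / 2) ^ 2 + c i * (t (e₂ i)) ^ 2)) ^ (-σ)‖ ∂(Measure.pi fun _ : κ₂ => (volume : Measure ℝ)) =
        ∏ j : κ₁, ((1 + ‖z j‖ ^ 2 / 2) ^ (1 - 2 * σ) * ((c (e₁.symm j)) ^ (-(1 / 2 : ℝ)) * ∫ u : ℝ, (1 + u ^ 2) ^ (-σ))) := by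
      intro z
      have h1 : ∫ t : κ₂ → ℝ, ‖(∏ i, ((1 + ‖z (e₁ i)‖ ^ 2 / 2) ^ 2 + c i * (t (e₂ i)) ^ 2)) ^ (-σ)‖ ∂(Measure.pi fun _ : κ₂ => (volume : Measure ℝ)) =
          ∫ t : κ₂ → ℝ, ∏ k : κ₂, ((1 + ‖z (e₁ (e₂.symm k))‖ ^ 2 / 2) ^ 2 + c (e₂.symm k) * (t k) ^ 2) ^ (-σ) ∂(Measure.pi fun _ : κ₂ => (volume : Measure ℝ)) := by
        refine integral_congr_ae (Eventually.of_forall fun t => ?_)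
        simp only
        rw [Real.norm_of_nonneg (Real.rpow_nonneg (Finset.prod_nonneg fun i _ => (hq _ i _).le) _), hslice]
      rw [h1, integral_fintype_prod_eq_prod (f := fun k (s : ℝ) => ((1 + ‖z (e₁ (e₂.symm k))‖ ^ 2 / 2) ^ 2 + c (e₂.symm k) * s ^ 2) ^ (-σ))]
      -- each one-place integral, then reindex `κ₂ ≃ ι ≃ κ₁`
      have h2 : ∀ k : κ₂, ∫ s : ℝ, ((1 + ‖z (e₁ (e₂.symm k))‖ ^ 2 / 2) ^ 2 + c (e₂.symm k) * s ^ 2) ^ (-σ) =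
          (1 + ‖z (e₁ (e₂.symm k))‖ ^ 2 / 2) ^ (1 - 2 * σ) * ((c (e₂.symm k)) ^ (-(1 / 2 : ℝ)) * ∫ u : ℝ, (1 + u ^ 2) ^ (-σ)) := by
        intro k
        rw [(integrable_and_integral_add_mul_sq_rpow_neg (pow_pos (by positivity : (0 : ℝ) < 1 + ‖z (e₁ (e₂.symm k))‖ ^ 2 / 2) 2) (hc _) hσ').2, ← mul_assoc]
        congr 1
        rw [← Real.rpow_natCast, ← Real.rpow_mul (by positivity)]
        congr 1
        push_cast
        ring
      simp_rw [h2]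
      exact Fintype.prod_equiv (e₂.symm.trans e₁) _ _ fun k => by simp only [Equiv.trans_apply, Equiv.symm_apply_apply]
    have hI : Integrable (fun z : κ₁ → ℂ => ∏ j : κ₁, ((1 + ‖z j‖ ^ 2 / 2) ^ (1 - 2 * σ) * ((c (e₁.symm j)) ^ (-(1 / 2 : ℝ)) * ∫ u : ℝ, (1 + u ^ 2) ^ (-σ))))
        (Measure.pi fun _ : κ₁ => (volume : Measure ℂ)) :=
      Integrable.fintype_prod (f := fun j (X : ℂ) => (1 + ‖X‖ ^ 2 / 2) ^ (1 - 2 * σ) * ((c (e₁.symm j)) ^ (-(1 / 2 : ℝ)) * ∫ u : ℝ, (1 + u ^ 2) ^ (-σ)))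
        fun j => (integrable_one_add_half_norm_sq_rpow hσ).mul_const _
    exact hI.congr (Eventually.of_forall fun z => (hmarg z).symm)

/-! ## §3 The adelic statement: `ARCH₃^{−σ} ∈ L¹(μ_{E,∞} ⊗ μ_{F,∞})` for `σ > 1` -/

variable (L : Type) [Field L] [NumberField L] [IsCMField L] {δ : L} (hδ : δ ≠ 0)

section Adelic

variable [MeasurableSpace (InfiniteAdeleRing L)] [BorelSpace (InfiniteAdeleRing L)]
  [MeasurableSpace (InfiniteAdeleRing ↥(maximalRealSubfield L))] [BorelSpace (InfiniteAdeleRing ↥(maximalRealSubfield L))]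
  (μE₁ : Measure (InfiniteAdeleRing L)) [μE₁.IsAddHaarMeasure] (μF₁ : Measure (InfiniteAdeleRing ↥(maximalRealSubfield L))) [μF₁.IsAddHaarMeasure]

omit [IsCMField L] [MeasurableSpace (InfiniteAdeleRing L)] [BorelSpace (InfiniteAdeleRing L)] [MeasurableSpace (InfiniteAdeleRing ↥(maximalRealSubfield L))]
  [BorelSpace (InfiniteAdeleRing ↥(maximalRealSubfield L))] in
/-- The archimedean place quadratics are `≥ 1`, so `ARCH₃(Ξ, a) ≥ 1`. [folklore] -/
theorem one_le_arch (Xi : InfiniteAdeleRing L) (a : InfiniteAdeleRing ↥(maximalRealSubfield L)) :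
    (1 : ℝ) ≤ ∏ w : InfinitePlace L, ((1 + ‖(Xi) w‖ ^ 2 / 2) ^ 2 + (w δ) ^ 2 * (((InfiniteAdeleRing.ringEquiv_mixedSpace ↥(maximalRealSubfield L)) a).1 ⟨w.comap (algebraMap ↥(maximalRealSubfield L) L), K2E1HeightBigCellLineFormulaU2.isReal_comap_maximalRealSubfield L w⟩) ^ 2) := by
  exact Finset.one_le_prod fun w _ => le_add_of_le_of_nonneg (one_le_pow₀ (le_add_of_nonneg_right (by positivity))) (by positivity)

omit [IsCMField L] [MeasurableSpace (InfiniteAdeleRing L)] [BorelSpace (InfiniteAdeleRing L)] [MeasurableSpace (InfiniteAdeleRing ↥(maximalRealSubfield L))]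
  [BorelSpace (InfiniteAdeleRing ↥(maximalRealSubfield L))] in
/-- **Monotonicity in `σ`**: since `ARCH₃ ≥ 1`, `ARCH₃^{−σ} ≤ ARCH₃^{−σ₀}` for `σ₀ ≤ σ`. [folklore] -/
theorem arch_rpow_neg_le_of_le {σ₀ σ : ℝ} (h : σ₀ ≤ σ) (Xi : InfiniteAdeleRing L) (a : InfiniteAdeleRing ↥(maximalRealSubfield L)) :
    (∏ w : InfinitePlace L, ((1 + ‖(Xi) w‖ ^ 2 / 2) ^ 2 + (w δ) ^ 2 * (((InfiniteAdeleRing.ringEquiv_mixedSpace ↥(maximalRealSubfield L)) a).1 ⟨w.comap (algebraMap ↥(maximalRealSubfield L) L), K2E1HeightBigCellLineFormulaU2.isReal_comap_maximalRealSubfield L w⟩) ^ 2)) ^ (-σ) ≤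
      (∏ w : InfinitePlace L, ((1 + ‖(Xi) w‖ ^ 2 / 2) ^ 2 + (w δ) ^ 2 * (((InfiniteAdeleRing.ringEquiv_mixedSpace ↥(maximalRealSubfield L)) a).1 ⟨w.comap (algebraMap ↥(maximalRealSubfield L) L), K2E1HeightBigCellLineFormulaU2.isReal_comap_maximalRealSubfield L w⟩) ^ 2)) ^ (-σ₀) :=
  Real.rpow_le_rpow_of_exponent_le (one_le_arch L Xi a) (neg_le_neg h)

omit [IsCMField L] [MeasurableSpace (InfiniteAdeleRing L)] [BorelSpace (InfiniteAdeleRing L)] [MeasurableSpace (InfiniteAdeleRing ↥(maximalRealSubfield L))]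
  [BorelSpace (InfiniteAdeleRing ↥(maximalRealSubfield L))] in
/-- `(Ξ, a) ↦ ARCH₃(Ξ, a)^{−σ}` is continuous (a polynomial in the archimedean norms, `≥ 1`, raised to `−σ`; ★ `continuous_ringEquiv_mixedSpace`). [folklore] -/
theorem continuous_arch_rpow_neg (σ : ℝ) :
    Continuous fun p : InfiniteAdeleRing L × InfiniteAdeleRing ↥(maximalRealSubfield L) =>
      (∏ w : InfinitePlace L, ((1 + ‖(p.1) w‖ ^ 2 / 2) ^ 2 + (w δ) ^ 2 * (((InfiniteAdeleRing.ringEquiv_mixedSpace ↥(maximalRealSubfield L)) p.2).1 ⟨w.comap (algebraMap ↥(maximalRealSubfield L) L), K2E1HeightBigCellLineFormulaU2.isReal_comap_maximalRealSubfield L w⟩) ^ 2)) ^ (-σ) := by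
  refine (continuous_finsetProd _ fun w _ => ?_).rpow_const fun p => Or.inl (lt_of_lt_of_le one_pos (one_le_arch L p.1 p.2)).ne'
  have h1 : Continuous fun p : InfiniteAdeleRing L × InfiniteAdeleRing ↥(maximalRealSubfield L) => ‖p.1 w‖ :=
    continuous_norm.comp ((continuous_apply w).comp continuous_fst)
  have h2 : Continuous fun p : InfiniteAdeleRing L × InfiniteAdeleRing ↥(maximalRealSubfield L) =>
      ((InfiniteAdeleRing.ringEquiv_mixedSpace ↥(maximalRealSubfield L)) p.2).1 ⟨w.comap (algebraMap ↥(maximalRealSubfield L) L), K2E1HeightBigCellLineFormulaU2.isReal_comap_maximalRealSubfield L w⟩ :=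
    (continuous_apply _).comp (continuous_fst.comp ((continuous_ringEquiv_mixedSpace ↥(maximalRealSubfield L)).comp continuous_snd))
  exact ((continuous_const.add ((h1.pow 2).div_const 2)).pow 2).add (continuous_const.mul (h2.pow 2))

include hδ in
/-- **`ARCH₃^{−σ} ∈ L¹(μ_{E,∞} ⊗ μ_{F,∞})` FOR EVERY REAL `σ > 1`** and all additive Haar measures (real-valued form): transport of §2 along `ringEquiv_mixedSpace` on both factors
(`‖Ξ_w‖ = ‖extensionEmbedding_w Ξ_w‖` by Mathlib `isometry_extensionEmbedding`; the empty real ∕ complex coordinate blocks of `mixedSpace L` ∕ `mixedSpace L⁺` are one-point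
probability spaces), ★ `AddEquiv.isAddHaarMeasure_map` and Haar uniqueness `isAddLeftInvariant_eq_smul` (`(ringEquiv)_* μ = c • volume`, `c < ∞`).
[cite: MoeglinWaldspurger1995, II.1.6–II.1.7] [cite: Langlands1976, Appendix] -/
theorem integrable_arch_rpow_neg_prod_real {σ : ℝ} (hσ : 1 < σ) :
    Integrable (fun p : InfiniteAdeleRing L × InfiniteAdeleRing ↥(maximalRealSubfield L) =>
      (∏ w : InfinitePlace L, ((1 + ‖(p.1) w‖ ^ 2 / 2) ^ 2 + (w δ) ^ 2 * (((InfiniteAdeleRing.ringEquiv_mixedSpace ↥(maximalRealSubfield L)) p.2).1 ⟨w.comap (algebraMap ↥(maximalRealSubfield L) L), K2E1HeightBigCellLineFormulaU2.isReal_comap_maximalRealSubfield L w⟩) ^ 2)) ^ (-σ))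
      (μE₁.prod μF₁) := by
  haveI : SecondCountableTopology (InfiniteAdeleRing L) := secondCountableTopology_infiniteAdeleRing L
  haveI : SecondCountableTopology (InfiniteAdeleRing ↥(maximalRealSubfield L)) := secondCountableTopology_infiniteAdeleRing _
  -- index bookkeeping: all places of `L` are complex, all places of `L⁺` are real
  have hcx : ∀ w : InfinitePlace L, w.IsComplex := fun w => IsTotallyComplex.isComplex w
  haveI : IsEmpty {w : InfinitePlace L // w.IsReal} := ⟨fun w => (not_isReal_iff_isComplex.2 (hcx w.1)) w.2⟩
  haveI : IsEmpty {v : InfinitePlace ↥(maximalRealSubfield L) // v.IsComplex} := ⟨fun v => (not_isComplex_iff_isReal.2 (IsTotallyReal.isReal v.1)) v.2⟩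
  set e₁ : InfinitePlace L ≃ {w : InfinitePlace L // w.IsComplex} := (Equiv.subtypeUnivEquiv hcx).symm with he₁
  set e₂ : InfinitePlace L ≃ {v : InfinitePlace ↥(maximalRealSubfield L) // v.IsReal} :=
    (IsCMField.equivInfinitePlace L).trans (Equiv.subtypeUnivEquiv (fun v : InfinitePlace ↥(maximalRealSubfield L) => IsTotallyReal.isReal v)).symm with he₂
  -- §2 on the core coordinates `B × C`, `B = (complex places of L → ℂ)`, `C = (real places of L⁺ → ℝ)`
  have hcore := integrable_prod_archPlace_rpow_neg e₁ e₂ (fun w : InfinitePlace L => (w δ) ^ 2) (fun w => pow_pos (InfinitePlace.pos_iff.2 hδ) 2) hσ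
  rw [← volume_pi, ← volume_pi] at hcore
  -- from `B × C` to `mixedSpace L × mixedSpace L⁺ = (A × B) × (C × D)` along `π q = (q.1.2, q.2.1)` (`A`, `D` one-point probability spaces)
  haveI : IsProbabilityMeasure (volume : Measure ({w : InfinitePlace L // w.IsReal} → ℝ)) :=
    ⟨by rw [volume_pi, Measure.pi_univ, Fintype.prod_empty]⟩
  haveI : IsProbabilityMeasure (volume : Measure ({v : InfinitePlace ↥(maximalRealSubfield L) // v.IsComplex} → ℂ)) :=
    ⟨by rw [volume_pi, Measure.pi_univ, Fintype.prod_empty]⟩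
  have hπ : MeasurePreserving (Prod.map Prod.snd Prod.fst : mixedSpace L × mixedSpace ↥(maximalRealSubfield L) → ({w : InfinitePlace L // w.IsComplex} → ℂ) × ({v : InfinitePlace ↥(maximalRealSubfield L) // v.IsReal} → ℝ))
      ((volume : Measure (mixedSpace L)).prod (volume : Measure (mixedSpace ↥(maximalRealSubfield L)))) (volume.prod volume) :=
    (measurePreserving_snd (μ := (volume : Measure ({w : InfinitePlace L // w.IsReal} → ℝ))) (ν := (volume : Measure ({w : InfinitePlace L // w.IsComplex} → ℂ)))).prod
      (measurePreserving_fst (μ := (volume : Measure ({v : InfinitePlace ↥(maximalRealSubfield L) // v.IsReal} → ℝ))) (ν := (volume : Measure ({v : InfinitePlace ↥(maximalRealSubfield L) // v.IsComplex} → ℂ))))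
  have hG : Integrable (fun q : mixedSpace L × mixedSpace ↥(maximalRealSubfield L) =>
      (∏ w : InfinitePlace L, ((1 + ‖q.1.2 (e₁ w)‖ ^ 2 / 2) ^ 2 + (w δ) ^ 2 * (q.2.1 (e₂ w)) ^ 2)) ^ (-σ))
      ((volume : Measure (mixedSpace L)).prod (volume : Measure (mixedSpace ↥(maximalRealSubfield L)))) :=
    (hπ.integrable_comp hcore.aestronglyMeasurable).2 hcore
  -- Haar transport along `ringEquiv_mixedSpace` on both factors
  have hmeL : MeasurableEmbedding (InfiniteAdeleRing.ringEquiv_mixedSpace L) := by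
    rw [← coe_infiniteAdeleRingHomeomorph]
    exact (infiniteAdeleRingHomeomorph L).measurableEmbedding
  have hmeF : MeasurableEmbedding (InfiniteAdeleRing.ringEquiv_mixedSpace ↥(maximalRealSubfield L)) := by
    rw [← coe_infiniteAdeleRingHomeomorph]
    exact (infiniteAdeleRingHomeomorph ↥(maximalRealSubfield L)).measurableEmbedding
  haveI : (μE₁.map (InfiniteAdeleRing.ringEquiv_mixedSpace L)).IsAddHaarMeasure :=
    AddEquiv.isAddHaarMeasure_map μE₁ (InfiniteAdeleRing.ringEquiv_mixedSpace L).toAddEquiv (continuous_ringEquiv_mixedSpace L) (continuous_ringEquiv_mixedSpace_symm L)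
  haveI : (μF₁.map (InfiniteAdeleRing.ringEquiv_mixedSpace ↥(maximalRealSubfield L))).IsAddHaarMeasure :=
    AddEquiv.isAddHaarMeasure_map μF₁ (InfiniteAdeleRing.ringEquiv_mixedSpace ↥(maximalRealSubfield L)).toAddEquiv (continuous_ringEquiv_mixedSpace _)
      (continuous_ringEquiv_mixedSpace_symm _)
  have hμL : μE₁.map (InfiniteAdeleRing.ringEquiv_mixedSpace L) = (μE₁.map (InfiniteAdeleRing.ringEquiv_mixedSpace L)).addHaarScalarFactor volume • volume :=
    isAddLeftInvariant_eq_smul _ _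
  have hμF : μF₁.map (InfiniteAdeleRing.ringEquiv_mixedSpace ↥(maximalRealSubfield L)) =
      (μF₁.map (InfiniteAdeleRing.ringEquiv_mixedSpace ↥(maximalRealSubfield L))).addHaarScalarFactor volume • volume :=
    isAddLeftInvariant_eq_smul _ _
  -- integrability for the product of the push-forwards
  have hG' : Integrable (fun q : mixedSpace L × mixedSpace ↥(maximalRealSubfield L) =>
      (∏ w : InfinitePlace L, ((1 + ‖q.1.2 (e₁ w)‖ ^ 2 / 2) ^ 2 + (w δ) ^ 2 * (q.2.1 (e₂ w)) ^ 2)) ^ (-σ))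
      ((μE₁.map (InfiniteAdeleRing.ringEquiv_mixedSpace L)).prod (μF₁.map (InfiniteAdeleRing.ringEquiv_mixedSpace ↥(maximalRealSubfield L)))) := by
    rw [hμL, hμF, Measure.prod_smul_left, Measure.prod_smul_right, ENNReal.smul_def, ENNReal.smul_def, smul_smul]
    exact hG.smul_measure (ENNReal.mul_ne_top ENNReal.coe_ne_top ENNReal.coe_ne_top)
  rw [Measure.map_prod_map _ _ hmeL.measurable hmeF.measurable] at hG'
  have hF := (integrable_map_measure hG'.aestronglyMeasurable (hmeL.measurable.prodMap hmeF.measurable).aemeasurable).1 hG'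
  refine hF.congr (Eventually.of_forall fun p => ?_)
  -- the integrands agree: `‖Ξ_w‖ = ‖(ringEquiv Ξ).2 ⟨w, _⟩‖`, and the real coordinate is read at `⟨w|L⁺, _⟩`
  simp only [Function.comp_apply, Prod.map_fst, Prod.map_snd]
  congr 1
  refine Finset.prod_congr rfl fun w _ => ?_
  have hn : ‖((InfiniteAdeleRing.ringEquiv_mixedSpace L) p.1).2 (e₁ w)‖ = ‖p.1 w‖ := by
    rw [InfiniteAdeleRing.ringEquiv_mixedSpace_apply]
    exact (Completion.isometry_extensionEmbedding w).norm_map_of_map_zero (map_zero _) (p.1 w)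
  rw [hn]
  rfl

include hδ in
/-- **HEAD (α).  `((ARCH₃^{−σ} : ℝ) : ℂ) ∈ L¹(μ_{E,∞} ⊗ μ_{F,∞})` FOR EVERY REAL `σ > 1`** — the currency of ★ FILE 3′ `K2E1IntertwiningFiniteIntegrabilityU3`; in particular at the pole
`σ = 2` of the `U(2,1)` intertwining constant. [cite: MoeglinWaldspurger1995, II.1.6–II.1.7] [cite: Langlands1976, Appendix] -/
theorem integrable_arch_rpow_neg_prod {σ : ℝ} (hσ : 1 < σ) :
    Integrable (fun p : InfiniteAdeleRing L × InfiniteAdeleRing ↥(maximalRealSubfield L) =>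
      ((((∏ w : InfinitePlace L, ((1 + ‖(p.1) w‖ ^ 2 / 2) ^ 2 + (w δ) ^ 2 * (((InfiniteAdeleRing.ringEquiv_mixedSpace ↥(maximalRealSubfield L)) p.2).1 ⟨w.comap (algebraMap ↥(maximalRealSubfield L) L), K2E1HeightBigCellLineFormulaU2.isReal_comap_maximalRealSubfield L w⟩) ^ 2))) ^ (-σ) : ℝ) : ℂ))
      (μE₁.prod μF₁) :=
  (integrable_arch_rpow_neg_prod_real L hδ μE₁ μF₁ hσ).ofReal

include hδ in
/-- **THE `σ`-UNIFORM ARCHIMEDEAN BOUND**: for `σ₀ > 1` and every `σ ≥ σ₀`,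
`‖∫_{L⊗ℝ} ∫_{L⁺⊗ℝ} ((ARCH₃(Ξ,a)^{−σ} : ℝ) : ℂ) dμ_{F,∞}(a) dμ_{E,∞}(Ξ)‖ ≤ ∫ ARCH₃^{−σ₀} d(μ_{E,∞} ⊗ μ_{F,∞})` (Fubini `integral_prod` for the integrable `ARCH₃^{−σ}`, then
`‖∫‖ ≤ ∫‖·‖` and monotonicity in `σ`). [cite: MoeglinWaldspurger1995, II.1.7] -/
theorem norm_integral_integral_arch_rpow_le {σ₀ σ : ℝ} (hσ₀ : 1 < σ₀) (hσ : σ₀ ≤ σ) :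
    ‖∫ Xi : InfiniteAdeleRing L, ∫ a : InfiniteAdeleRing ↥(maximalRealSubfield L), ((((∏ w : InfinitePlace L, ((1 + ‖(Xi) w‖ ^ 2 / 2) ^ 2 + (w δ) ^ 2 * (((InfiniteAdeleRing.ringEquiv_mixedSpace ↥(maximalRealSubfield L)) a).1 ⟨w.comap (algebraMap ↥(maximalRealSubfield L) L), K2E1HeightBigCellLineFormulaU2.isReal_comap_maximalRealSubfield L w⟩) ^ 2))) ^ (-σ) : ℝ) : ℂ) ∂μF₁ ∂μE₁‖ ≤
      ∫ p : InfiniteAdeleRing L × InfiniteAdeleRing ↥(maximalRealSubfield L),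
        (∏ w : InfinitePlace L, ((1 + ‖(p.1) w‖ ^ 2 / 2) ^ 2 + (w δ) ^ 2 * (((InfiniteAdeleRing.ringEquiv_mixedSpace ↥(maximalRealSubfield L)) p.2).1 ⟨w.comap (algebraMap ↥(maximalRealSubfield L) L), K2E1HeightBigCellLineFormulaU2.isReal_comap_maximalRealSubfield L w⟩) ^ 2)) ^ (-σ₀) ∂(μE₁.prod μF₁) := by
  haveI : SecondCountableTopology (InfiniteAdeleRing L) := secondCountableTopology_infiniteAdeleRing L
  haveI : SecondCountableTopology (InfiniteAdeleRing ↥(maximalRealSubfield L)) := secondCountableTopology_infiniteAdeleRing _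
  have hint := integrable_arch_rpow_neg_prod L hδ μE₁ μF₁ (lt_of_lt_of_le hσ₀ hσ)
  have hint₀ := integrable_arch_rpow_neg_prod_real L hδ μE₁ μF₁ hσ₀
  rw [← integral_prod _ hint]
  refine (norm_integral_le_integral_norm _).trans (integral_mono_of_nonneg (Eventually.of_forall fun p => norm_nonneg _) hint₀ (Eventually.of_forall fun p => ?_))
  simp only
  rw [Complex.norm_real, Real.norm_of_nonneg (Real.rpow_nonneg (zero_le_one.trans (one_le_arch L p.1 p.2)) _)]
  exact arch_rpow_neg_le_of_le L hσ p.1 p.2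

end Adelic

end Summit.HodgeConjecture.HodgeConjecture.Cruxes.H413.K2E1IntertwiningArchFactorIntegrableU3

end
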